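import Literature.NumberTheory.Transcendental.KontsevichZagier
import Literature.NumberTheory.Transcendental.KontsevichZagierEllipticLift
import Literature.NumberTheory.Transcendental.KontsevichZagierEllipticParity
import Literature.NumberTheory.Transcendental.KontsevichZagierEllipticIntegrand
import HarnessLib

/-!
# Elliptic periods and quasi-periods are Kontsevich–Zagier periods (discharges)

Topic `Literature/NumberTheory/Transcendental` (family `periods`). This file **discharges** the
two elliptic quasi-period facts of `KontsevichZagier.lean` (**periods.S06**):

* `Literature.NumberTheory.Transcendental.isPeriod_η₂_holds` — for a period pair `L` with
  algebraic invariants `g₂(Λ), g₃(Λ)`, the quasi-period `η₂ = 2ζ(ω₂/2)` is a period;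
* `Literature.NumberTheory.Transcendental.isPeriod_η₁_holds` — likewise `η₁`.

(The companion fact `isPeriod_of_mem_lattice` is discharged independently in the tree's
`KontsevichZagierLatticeProofs.lean`; the same segment data would also give it, via
`isPeriod_of_mem_lattice_of_segments`.)

Source: M. Kontsevich, D. Zagier, *Periods* (2001), §1.1, list of examples following the
Definition: the periods `∮ dx/y` and quasi-periods `-∮ x dx/y` (elliptic integrals of the first and
second kind) of an elliptic curve `y² = 4x³ - g₂x - g₃` defined over `ℚ̄` are periods; no proof is
printed there (cf. Huber–Müller-Stach 2017, Ch. 14, for the cohomological framework). The proof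
formalised in the tree is elementary and avoids the topology of the double cover
`E(ℂ) → ℙ¹(ℂ)`:

1. (`KontsevichZagierEllipticParity.lean`) the cubic `f = 4x³ - g₂x - g₃` has three distinct
   simple roots, algebraic when `g₂, g₃` are (`isAlgebraic_of_cubic_eq_zero`), and one can pick a
   root `p` such that the closed segments `[p, q]`, `[p, r]` to the other two contain no further
   root (`exists_roots_with_vertex`);
2. (`KontsevichZagierEllipticIntegrand.lean`) along such a segment the algebraic branch
   `y = ν√(f(x(s))/ν²)` of `√f` is differentiable on `(0, 1)`;
3. (`KontsevichZagierEllipticLift.lean`, on top of `KontsevichZagierEllipticLiftProofs.lean`)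
   the lift `w' = (q - p)/y`, `(℘, ℘') ∘ w = (x, y)` (ODE uniqueness) joins two half-lattice
   points `w₀, w₁` over `p, q`, with `w₁ - w₀ = ∫ₚ^q dx/y` and `ζ(w₁) - ζ(w₀) = -∫ₚ^q x dx/y`,
   absolutely convergent integrals of functions with `ℚ`-semialgebraic real and imaginary parts
   over `(0, 1)`, hence periods (step 2 and `KZIntervalPeriodProofs.lean`,
   `KZSemialgebraicComplex.lean`, ultimately `KZ.isRealPeriod_iff_exists_integralRep_holds` and
   the Tarski–Seidenberg theorem);
4. (`KontsevichZagierEllipticParity.lean`) the two segments give lattice vectors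
   `2(w₁ - w₀) = αω₁ + βω₂`, `2(w₁' - w₀') = γω₁ + δω₂` with `αδ - βγ` **odd** (parity in `Λ/2Λ`),
   and half-quasi-periods `2(ζ(w₁) - ζ(w₀)) = αη₁ + βη₂`, `2(ζ(w₁') - ζ(w₀')) = γη₁ + δη₂`;
   Cramer's rule in the `ℚ`-algebra of periods yields `η₁, η₂` (and `ω₁, ω₂`).

## References

* M. Kontsevich, D. Zagier, *Periods*, in: Mathematics Unlimited — 2001 and Beyond, Springer
  (2001), §1.1.
* A. Huber, S. Müller-Stach, *Periods and Nori Motives*, Springer (2017), Ch. 14.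
* E. T. Whittaker, G. N. Watson, *A Course of Modern Analysis*, §20.22, §20.32, §20.41.
-/

noncomputable section

open Complex Set MeasureTheory intervalIntegral
open scoped PeriodPair

namespace Literature.NumberTheory.Transcendental

variable (L : PeriodPair)

/-- **Segment data.** For a period pair with algebraic invariants and a clean segment `[p, q]`
between two algebraic roots of the Weierstrass cubic (`(q - p)s + 2p + q ≠ 0` on `[0, 1]`), there
are half-lattice representatives `w₀, w₁` over `p, q` such that both the half-period `w₁ - w₀`
(`= ∫ₚ^q dx/y`) and the half-quasi-period `ζ(w₁) - ζ(w₀)` (`= -∫ₚ^q x dx/y`) are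
Kontsevich–Zagier periods. [Kontsevich–Zagier 2001, §1.1] [cite: KontsevichZagier2001, §1.1] -/
theorem exists_segment_periods (h₂ : IsAlgebraic ℚ L.g₂) (h₃ : IsAlgebraic ℚ L.g₃) {p q : ℂ}
    (hp : 4 * p ^ 3 - L.g₂ * p - L.g₃ = 0) (hq : 4 * q ^ 3 - L.g₂ * q - L.g₃ = 0) (hpq : p ≠ q)
    (hpa : IsAlgebraic ℚ p) (hqa : IsAlgebraic ℚ q)
    (hℓ : ∀ s ∈ Icc (0 : ℝ) 1, (q - p) * s + (2 * p + q) ≠ 0) :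
    ∃ w₀ w₁ : ℂ, w₀ ∉ L.lattice ∧ w₁ ∉ L.lattice ∧ 2 * w₀ ∈ L.lattice ∧ 2 * w₁ ∈ L.lattice ∧
      ℘[L] w₀ = p ∧ ℘[L] w₁ = q ∧ IsPeriod (w₁ - w₀) ∧
      IsPeriod (L.weierstrassZeta w₁ - L.weierstrassZeta w₀) := by
  have hℓ' : ∀ s ∈ Ioo (0 : ℝ) 1, (q - p) * s + (2 * p + q) ≠ 0 :=
    fun s hs => hℓ s (Ioo_subset_Icc_self hs)
  -- the value `f(x(1/2)) ≠ 0` normalising the branch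
  have hhalf : (1 / 2 : ℝ) ∈ Icc (0 : ℝ) 1 := ⟨by norm_num, by norm_num⟩
  have hν : 4 * (p + (1 / 2 : ℝ) * (q - p)) ^ 3 - L.g₂ * (p + (1 / 2 : ℝ) * (q - p)) - L.g₃ ≠ 0 := by
    rw [cubic_segment_eq hp hq]
    have hd : q - p ≠ 0 := sub_ne_zero.2 (Ne.symm hpq)
    refine mul_ne_zero (mul_ne_zero (mul_ne_zero (mul_ne_zero (by norm_num) (pow_ne_zero 2 hd))
      (by norm_num)) (by norm_num)) (hℓ _ hhalf)
  -- the algebraic branch and the lift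
  obtain ⟨w₀, w₁, hw₀, hw₁, h2w₀, h2w₁, hP₀, hP₁, hint₁, hint₂, hT, hS⟩ :=
    exists_segmentLift L hp hq hpq hℓ
      (y := fun s : ℝ =>
        Complex.sqrt (4 * (p + (1 / 2 : ℝ) * (q - p)) ^ 3 - L.g₂ * (p + (1 / 2 : ℝ) * (q - p)) -
            L.g₃) *
          Complex.sqrt ((4 * (p + s * (q - p)) ^ 3 - L.g₂ * (p + s * (q - p)) - L.g₃) /
            Complex.sqrt (4 * (p + (1 / 2 : ℝ) * (q - p)) ^ 3 -
              L.g₂ * (p + (1 / 2 : ℝ) * (q - p)) - L.g₃) ^ 2))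
      (fun s _ => sq_ellipticBranch hν)
      (fun s hs => differentiableAt_ellipticBranch hp hq hpq hℓ' hs)
  obtain ⟨hTP, hSP⟩ :=
    isPeriod_ellipticIntegrals_segment h₂ h₃ hpa hqa hp hq hpq hℓ' hint₁ hint₂
  refine ⟨w₀, w₁, hw₀, hw₁, h2w₀, h2w₁, hP₀, hP₁, ?_, ?_⟩
  · rw [hT]
    exact hTP
  · rw [hS]
    exact hSP.neg

/-- **`η₁` and `η₂` are periods** for algebraic `g₂, g₃` (two clean segments from a common root,
`exists_segment_periods`, and the parity/Cramer extraction `isPeriod_η₁_η₂_of_segments`).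
[Kontsevich–Zagier 2001, §1.1] [cite: KontsevichZagier2001, §1.1] -/
theorem isPeriod_η₁_and_η₂ (h₂ : IsAlgebraic ℚ L.g₂) (h₃ : IsAlgebraic ℚ L.g₃) :
    IsPeriod L.η₁ ∧ IsPeriod L.η₂ := by
  obtain ⟨p, q, r, hp, hq, hr, hpq, hpr, hqr, -, hs₁, hs₂⟩ := exists_roots_with_vertex L
  have hpa := isAlgebraic_of_cubic_eq_zero h₂ h₃ hp
  have hqa := isAlgebraic_of_cubic_eq_zero h₂ h₃ hq
  have hra := isAlgebraic_of_cubic_eq_zero h₂ h₃ hr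
  obtain ⟨w₀, w₁, hw₀, -, h2w₀, h2w₁, hP₀, hP₁, -, hS⟩ :=
    exists_segment_periods L h₂ h₃ hp hq hpq hpa hqa hs₁
  obtain ⟨w₀', w₁', hw₀', -, h2w₀', h2w₁', hP₀', hP₁', -, hS'⟩ :=
    exists_segment_periods L h₂ h₃ hp hr hpr hpa hra hs₂
  exact isPeriod_η₁_η₂_of_segments hw₀ hw₀' h2w₀ h2w₁ h2w₀' h2w₁' (hP₀.trans hP₀'.symm)
    (by rwa [hP₀, hP₁]) (by rwa [hP₀', hP₁']) (by rwa [hP₁, hP₁']) hS hS'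

/-- Discharge of `Literature.NumberTheory.Transcendental.isPeriod_η₂` (**periods.S06**): for a
period pair with algebraic invariants `g₂, g₃`, the quasi-period `η₂` — the elliptic integral of
the second kind `-∮ x dx/y` on `y² = 4x³ - g₂x - g₃` over `ℚ̄` — is a Kontsevich–Zagier period.
[Kontsevich–Zagier 2001, §1.1, examples of periods] [cite: KontsevichZagier2001, §1.1] -/
theorem isPeriod_η₂_holds : isPeriod_η₂ := fun L h₂ h₃ => (isPeriod_η₁_and_η₂ L h₂ h₃).2

/-- Discharge of `Literature.NumberTheory.Transcendental.isPeriod_η₁` (**periods.S06**): for a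
period pair with algebraic invariants `g₂, g₃`, the quasi-period `η₁` is a Kontsevich–Zagier
period. [Kontsevich–Zagier 2001, §1.1, examples of periods] [cite: KontsevichZagier2001, §1.1] -/
theorem isPeriod_η₁_holds : isPeriod_η₁ := fun L h₂ h₃ => (isPeriod_η₁_and_η₂ L h₂ h₃).1

end Literature.NumberTheory.Transcendental
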